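import Mathlib.Topology.Instances.Complex
import Literature.Probability.RandomPlanarGeometry.HexParafermion
import Literature.Probability.RandomPlanarGeometry.HexSAW
import Literature.Probability.LatticeModels.TriangularLatticeProofs

/-!
# Objects of the line `liouville-local-limits` for the crux `InteriorFlattening` (stmt-CriticalPhenomena-8297)

Lead prover `prover-line-stmt-CriticalPhenomena-8297-c1-0` (crux protocol; skeleton
`Summits/CriticalPhenomena/SAWScalingLimit/Cruxes/InteriorFlattening/Lines/liouville_local_limits.lean`,
planner `planner-cruxplan-stmt-CriticalPhenomena-8297-liouville-local-limi-0`). This file only DEFINES the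
objects the line's seven registered stubs speak about, so that the stub files under `Theorems/` and the
lead's skeleton share ONE copy of them (the skeleton's blocks "The objects of the crux", "The origin vertex,
its star, the 120° rotation", "Local limits at the origin", "Lattice balls, pictures, picture domains" are
byte-identical to the bodies below and are replaced by this import once the module lands). No statement of
the line is asserted or even named here.

The crux (M) = `…Theses.SAWDevelopingMap.InteriorFlattening`: bulk flattening of the Duminil-Copin–Smirnov
parafermionic observable `F = F(a, ·, x_c, 5/8)` of a simply connected hexagonal domain — the Beltrami mode
`‖F{v,w₀} + ωF{v,w₁} + ω²F{v,w₂}‖` is at most `ε` times the monopole `‖F{v,w₀} + F{v,w₁} + F{v,w₂}‖` at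
every `R(ε)`-deep vertex. The line recentres deep configurations at the origin vertex `O`, normalises by
the monopole `M(O)`, and studies the class of pointwise LOCAL LIMITS of such fields (a unique local limit is
its own `120°`-rotation, hence flat). The objects are:

* `xc`, `obs Λ a z` — the observable at `(x_c, 5/8)`; `omega = e^{2πi/3}`; `fieldMono`, `fieldBelt` — the
  monopole and the `ω`-combination of an arbitrary lattice field at a vertex in a frame; `Deep Λ v R` — the
  crux's ball hypothesis; `RatioAtDepth R η` — the crux matrix "quotient `≤ η` at depth `R`" (the crux is
  `∀ ε > 0, ∃ R, RatioAtDepth R ε`, definitionally);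
* `O`, `nbA`, `nbB`, `nbC` — the origin vertex and its three neighbours; `rotO` — the rotation by `+120°`
  about the centre of `O` as a map of vertices;
* `Adm n Λ a` — admissible configurations at depth `n`; `obsMono` — the monopole at `O`; `LocalLimits` — the
  class of lattice-scale local limits;
* `boxR`, `latticeBall s` — the Euclidean lattice ball `B_s(O)` as a `Finset`; `Picture`, `darts S`, `Pic S`,
  `picRoot`, `picDom`, `GoodPic`, `amp`, `picField`, `picMono`, `innerEdges r`, `Clean`, `PicLimits` — the
  objects of the last-exit factorisation at one scale and the sub-family of picture-domain limits.

Plus ONE API lemma, `mem_latticeBall_iff` (the box cut-off loses no vertex: `w ∈ latticeBall s ↔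
dist (c w) (c O) ≤ s`), which every stub file needs, with its corollary `deep_O_iff_latticeBall_subset` (the
registered sub-goal this file carries). Sources: H. Duminil-Copin, S. Smirnov, Ann. of Math. 175
(2012) 1653–1665 (arXiv:1007.0575), §1–2 (walks between mid-edges, Definition 1); the line card
`Cruxes/InteriorFlattening/Lines/liouville-local-limits.md`. Deliberately NOT here: the seven statements
(`BulkNoFold`, `CompactnessAtOrigin`, `LastExitFactorisation`, `PictureLimitsUnique`, `FarFieldCoherence`,
`IntrusionTail`, `UniquenessReduction`) and any theorem about them.
-/

noncomputable section

open scoped BigOperators Topology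
open Filter Literature.Probability.LatticeModels Literature.Probability.RandomPlanarGeometry.SAW

namespace Summit.CriticalPhenomena.SAWScalingLimit.Theorems.InteriorFlattening.Liouville

/-! ### The objects of the crux -/

/-- `x_c = 1/√(2+√2)`, the critical fugacity of the hexagonal lattice (DCS 2012, §1). -/
abbrev xc : ℝ := hexCriticalFugacity

/-- `ω = e^{2πi/3}` (literally the crux's `ω`). -/
def omega : ℂ := Complex.exp (2 * Real.pi * Complex.I / 3)

/-- The DCS observable at `(x_c, 5/8)` of the domain `Λ` with root `a`, at the mid-edge `z`
(DCS 2012, Definition 1; literally the crux's `F`). -/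
def obs (Λ : Finset HexVertex) (a z : Sym2 HexVertex) : ℂ :=
  hexParafermionicObservable Λ a xc (5 / 8) z

/-- Monopole (sum mode) of a lattice field `G` at `v` in the frame `(w₀, w₁, w₂)`:
`G{v,w₀} + G{v,w₁} + G{v,w₂}`. -/
def fieldMono (G : Sym2 HexVertex → ℂ) (v w₀ w₁ w₂ : HexVertex) : ℂ :=
  G s(v, w₀) + G s(v, w₁) + G s(v, w₂)

/-- `ω`-combination of a lattice field at `v` in the frame `(w₀, w₁, w₂)`:
`G{v,w₀} + ω G{v,w₁} + ω² G{v,w₂}` (the Beltrami mode for clockwise frames, the DCS mode — zero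
for the observable — for counter-clockwise ones). -/
def fieldBelt (G : Sym2 HexVertex → ℂ) (v w₀ w₁ w₂ : HexVertex) : ℂ :=
  G s(v, w₀) + omega * G s(v, w₁) + omega ^ 2 * G s(v, w₂)

/-- `v` is `R`-deep in `Λ`: the Euclidean `R`-ball of lattice vertices around `v` lies in `Λ`
(the crux's ball hypothesis, verbatim). -/
def Deep (Λ : Finset HexVertex) (v : HexVertex) (R : ℝ) : Prop :=
  ∀ w : HexVertex, dist (hexCenter w) (hexCenter v) ≤ R → w ∈ Λ

/-- `RatioAtDepth R η`: the crux's inequality with `ε ↦ η` at depth `R`, uniformly over simply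
connected `Λ`, boundary roots, `R`-deep vertices and frames. The crux is literally
`∀ ε > 0, ∃ R, RatioAtDepth R ε`. -/
def RatioAtDepth (R η : ℝ) : Prop :=
  ∀ (Λ : Finset HexVertex), hexDomainSimplyConnected Λ → ∀ a ∈ hexDomainBoundary Λ, ∀ v ∈ Λ,
    Deep Λ v R → ∀ w₀ w₁ w₂ : HexVertex, hexGraph.Adj v w₀ → hexGraph.Adj v w₁ → hexGraph.Adj v w₂ →
      w₀ ≠ w₁ → w₁ ≠ w₂ → w₀ ≠ w₂ →
        ‖fieldBelt (obs Λ a) v w₀ w₁ w₂‖ ≤ η * ‖fieldMono (obs Λ a) v w₀ w₁ w₂‖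

/-! ### The origin vertex, its star, the `120°` rotation -/

/-- The origin vertex `O` (up triangle of the cell `0`). -/
def O : HexVertex := ((0 : Site 2), (0 : Fin 2))

/-- Neighbour `A = (0, 1)` of `O`. -/
def nbA : HexVertex := ((0 : Site 2), (1 : Fin 2))

/-- Neighbour `B = (-e₀, 1)` of `O`. -/
def nbB : HexVertex := ((-(Pi.single 0 1) : Site 2), (1 : Fin 2))

/-- Neighbour `C = (-e₁, 1)` of `O`. -/
def nbC : HexVertex := ((-(Pi.single 1 1) : Site 2), (1 : Fin 2))

/-- Rotation by `+120°` about the centre of `O`: on cells `x ↦ R² x` (`R = triRot60`,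
`(a, b) ↦ (-a-b, a)`), shifted by `-e₀` on down triangles; a graph automorphism of the honeycomb
fixing `O`, acting on embedded positions by `z ↦ c_O + ω (z - c_O)` and permuting the star of `O`
cyclically (`A ↦ B ↦ C ↦ A`). -/
def rotO (f : HexVertex) : HexVertex :=
  (triRot60 (triRot60 f.1) - (if f.2 = 1 then Pi.single 0 1 else 0), f.2)

/-! ### Local limits at the origin -/

/-- An ADMISSIBLE configuration at depth `n`: simply connected domain, boundary root, `O` `n`-deep.
Every configuration of the crux is transported here by a lattice symmetry (translations and the
central flip act trivially on the observable: intrinsic windings and lengths). -/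
def Adm (n : ℕ) (Λ : Finset HexVertex) (a : Sym2 HexVertex) : Prop :=
  hexDomainSimplyConnected Λ ∧ a ∈ hexDomainBoundary Λ ∧ Deep Λ O n

/-- The monopole of the observable at `O` (canonical frame; frame-independent, it is a sum). -/
def obsMono (Λ : Finset HexVertex) (a : Sym2 HexVertex) : ℂ :=
  fieldMono (obs Λ a) O nbA nbB nbC

/-- **The class `𝓕` of LATTICE-SCALE LOCAL LIMITS**: pointwise limits, on every edge of the
infinite honeycomb, of the `M(O)`-normalised observables of admissible configurations of depth
`→ ∞` (depth `≥ n` at index `n`; passing to a subsequence preserves this); fields are set to `0`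
off the edge set so that equality of limits is equality of functions. -/
def LocalLimits : Set (Sym2 HexVertex → ℂ) :=
  {G | (∀ z : Sym2 HexVertex, z ∉ hexGraph.edgeSet → G z = 0) ∧
    ∃ (Λ : ℕ → Finset HexVertex) (a : ℕ → Sym2 HexVertex),
      (∀ n, Adm n (Λ n) (a n)) ∧ (∀ n, obsMono (Λ n) (a n) ≠ 0) ∧
      ∀ z ∈ hexGraph.edgeSet,
        Tendsto (fun n => obs (Λ n) (a n) z / obsMono (Λ n) (a n)) atTop (𝓝 (G z))}

/-! ### Lattice balls, pictures, picture domains (domain-free, universal index sets) -/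

/-- Box radius large enough that the box of cells contains every vertex within distance `s` of
`c_O` (`|xᵢ| ≤ 2 ‖triEmbed x‖ ≤ 2 (s + 1/√3) < 2 s + 2`, `mem_latticeBall_iff`). -/
def boxR (s : ℝ) : ℕ := ⌈2 * s⌉₊ + 2

/-- The LATTICE BALL `B_s(O)`: all honeycomb vertices whose centre is within Euclidean distance
`s` of `c_O`, as a `Finset` (cut out of a box of cells). `Deep Λ O s ↔ latticeBall s ⊆ Λ`. -/
def latticeBall (s : ℝ) : Finset HexVertex :=
  ((Fintype.piFinset fun _ : Fin 2 => Finset.Icc (-(boxR s : ℤ)) (boxR s)) ×ˢ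
      (Finset.univ : Finset (Fin 2))).filter fun w => dist (hexCenter w) (hexCenter O) ≤ s

/-- A PICTURE at scale `S`: (intrusion set inside `B_S(O)`, entrance dart `y → z` with `y`
outside and `z` inside `B_S(O)`). -/
abbrev Picture : Type := Finset HexVertex × HexVertex × HexVertex

/-- Entrance darts into `B_S(O)`: `(y, z)` with `y ∈ B_{S+1}(O) ∖ B_S(O)`, `z ∈ B_S(O)`, `y ∼ z`. -/
def darts (S : ℝ) : Finset (HexVertex × HexVertex) :=
  ((latticeBall (S + 1) \ latticeBall S) ×ˢ latticeBall S).filter fun d => hexGraph.Adj d.1 d.2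

/-- The finite, universal index set of pictures at scale `S`. -/
def Pic (S : ℝ) : Finset Picture := (latticeBall S).powerset ×ˢ darts S

/-- The root mid-edge of a picture (its entrance dart). -/
def picRoot (P : Picture) : Sym2 HexVertex := s(P.2.1, P.2.2)

/-- The PICTURE DOMAIN of `P` inside a domain `D` at scale `S`: `(D ∩ B_S(O)) ∖ intrusions`
(for `S`-deep `D` this is `B_S(O) ∖ P.1`, a domain with NO far field). -/
def picDom (D : Finset HexVertex) (S : ℝ) (P : Picture) : Finset HexVertex :=
  (D ∩ latticeBall S) \ P.1

/-- A GOOD picture: its (domain-free) picture domain `B_S(O) ∖ P.1` is simply connected and the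
dart head is not an intrusion. Every picture realised by a prefix from a root outside `B_S(O)`
with non-vanishing inner observable is good; the other pictures contribute `0` to every
factorisation (`amp = 0` or inner observable `= 0`). -/
def GoodPic (S : ℝ) (P : Picture) : Prop :=
  hexDomainSimplyConnected (latticeBall S \ P.1) ∧ P.2.2 ∉ P.1

/-- PREFIX AMPLITUDE of the picture `P` for the configuration `(D, ρ)` at scale `S`: the sum of
`e^{-iσW} x_c^ℓ` over the walks `ρ → mid(y,z)` arriving from `y = P.2.1` (outside the ball) whose
vertices inside `B_S(O)` are exactly the intrusion set `P.1`. This is the far field; it is never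
expanded. -/
def amp (D : Finset HexVertex) (ρ : Sym2 HexVertex) (S : ℝ) (P : Picture) : ℂ :=
  ∑ ψ : HexMidEdgeSAW D ρ (picRoot P),
    if ψ.verts.getLast? = some P.2.1 ∧ ψ.verts.toFinset ∩ latticeBall S = P.1
    then ψ.weight xc (5 / 8) else 0

/-- The field of the DOMAIN-FREE picture domain `B_S(O) ∖ P.1` rooted at its dart. -/
def picField (S : ℝ) (P : Picture) : Sym2 HexVertex → ℂ :=
  obs (latticeBall S \ P.1) (picRoot P)

/-- Its monopole at `O`. -/
def picMono (S : ℝ) (P : Picture) : ℂ := fieldMono (picField S P) O nbA nbB nbC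

/-- The edges of the honeycomb with both endpoints in `B_r(O)` (the comparison set; contains the
star of `O` once `r ≥ 1`). -/
def innerEdges (r : ℝ) : Finset (Sym2 HexVertex) :=
  ((latticeBall r ×ˢ latticeBall r).filter fun p => hexGraph.Adj p.1 p.2).image fun p => s(p.1, p.2)

/-- A picture is `s̄`-CLEAN when its intrusions avoid `B_{s̄}(O)`. -/
def Clean (sbar : ℝ) (P : Picture) : Prop := Disjoint P.1 (latticeBall sbar)

/-- **The sub-family: local limits of PICTURE DOMAINS.** Pointwise limits of the
`m(O)`-normalised fields of good picture domains `B_{S_n}(O) ∖ P_n.1` (dart root on the sphere of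
radius `S_n ≥ n`) whose cleanliness radius is `≥ n` at index `n` — lattice balls with
boundary-hanging arcs, all features receding. A sub-class of `LocalLimits` (picture domains are
admissible configurations, `O` is `n`-deep in them). -/
def PicLimits : Set (Sym2 HexVertex → ℂ) :=
  {G | (∀ z : Sym2 HexVertex, z ∉ hexGraph.edgeSet → G z = 0) ∧
    ∃ (S : ℕ → ℝ) (P : ℕ → Picture),
      (∀ n : ℕ, (n : ℝ) ≤ S n ∧ P n ∈ Pic (S n) ∧ GoodPic (S n) (P n) ∧ Clean (n : ℝ) (P n)) ∧
      (∀ n, picMono (S n) (P n) ≠ 0) ∧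
      ∀ z ∈ hexGraph.edgeSet,
        Tendsto (fun n => picField (S n) (P n) z / picMono (S n) (P n)) atTop (𝓝 (G z))}

/-! ### The one API lemma carried by this file: the box cut-off loses nothing -/

/-- `c(x, j) - c(O) = triEmbed x + j · (1 + ζ)/3`. -/
theorem hexCenter_sub_hexCenter_O (w : HexVertex) :
    hexCenter w - hexCenter O = triEmbed w.1 + ((w.2 : ℕ) : ℂ) * ((1 + triZeta) / 3) := by
  simp only [hexCenter, O, triEmbed_zero, Fin.val_zero, Nat.cast_zero]
  ring

/-- `‖(1 + ζ)/3‖ ≤ 1` (indeed `= 1/√3`). -/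
theorem norm_one_add_triZeta_div_three_le_one : ‖(1 + triZeta) / 3‖ ≤ 1 := by
  have hn : Complex.normSq (1 + triZeta) = 3 := by
    have h3 : Real.sqrt 3 * Real.sqrt 3 = 3 := Real.mul_self_sqrt (by norm_num)
    rw [Complex.normSq_apply]
    simp only [Complex.add_re, Complex.one_re, triZeta_re, Complex.add_im, Complex.one_im, triZeta_im]
    nlinarith [h3]
  have hsq : ‖(1 + triZeta) / 3‖ ^ 2 = 1 / 3 := by
    rw [norm_div, div_pow, ← Complex.normSq_eq_norm_sq, hn]
    norm_num
  nlinarith [norm_nonneg ((1 + triZeta) / 3), hsq]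

/-- Every vertex within distance `s` of `c_O` has cell coordinates bounded by `boxR s`. -/
theorem abs_le_boxR_of_dist_le {s : ℝ} {w : HexVertex} (h : dist (hexCenter w) (hexCenter O) ≤ s)
    (i : Fin 2) : |(w.1 i : ℝ)| ≤ boxR s := by
  have hE : ‖triEmbed w.1‖ ≤ s + 1 := by
    have e : triEmbed w.1 = (hexCenter w - hexCenter O) - ((w.2 : ℕ) : ℂ) * ((1 + triZeta) / 3) := by
      rw [hexCenter_sub_hexCenter_O]; ring
    have hj : ‖((w.2 : ℕ) : ℂ) * ((1 + triZeta) / 3)‖ ≤ 1 := by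
      rw [norm_mul, Complex.norm_natCast]
      have hw2 : ((w.2 : ℕ) : ℝ) ≤ 1 := by
        have := w.2.isLt
        exact_mod_cast Nat.lt_succ_iff.1 this
      calc ((w.2 : ℕ) : ℝ) * ‖(1 + triZeta) / 3‖ ≤ 1 * 1 :=
            mul_le_mul hw2 norm_one_add_triZeta_div_three_le_one (norm_nonneg _) zero_le_one
        _ = 1 := one_mul _
    calc ‖triEmbed w.1‖ = ‖(hexCenter w - hexCenter O) - ((w.2 : ℕ) : ℂ) * ((1 + triZeta) / 3)‖ := by
          rw [← e]
      _ ≤ ‖hexCenter w - hexCenter O‖ + ‖((w.2 : ℕ) : ℂ) * ((1 + triZeta) / 3)‖ := norm_sub_le _ _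
      _ ≤ s + 1 := add_le_add (by rwa [← dist_eq_norm]) hj
  calc |(w.1 i : ℝ)| ≤ 2 * ‖triEmbed w.1‖ := abs_le_two_mul_norm_triEmbed w.1 i
    _ ≤ 2 * (s + 1) := by linarith
    _ = 2 * s + 2 := by ring
    _ ≤ (⌈2 * s⌉₊ : ℝ) + 2 := by linarith [Nat.le_ceil (2 * s)]
    _ = (boxR s : ℝ) := by simp [boxR]

/-- **The lattice ball is the Euclidean ball of lattice vertices**: the box cut-off in the
definition of `latticeBall` loses no vertex, so `w ∈ latticeBall s ↔ dist (c w) (c O) ≤ s`. In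
particular `Deep Λ O s ↔ latticeBall s ⊆ Λ`. -/
theorem mem_latticeBall_iff {s : ℝ} {w : HexVertex} :
    w ∈ latticeBall s ↔ dist (hexCenter w) (hexCenter O) ≤ s := by
  simp only [latticeBall, Finset.mem_filter, Finset.mem_product, Finset.mem_univ, and_true,
    Fintype.mem_piFinset, Finset.mem_Icc]
  constructor
  · exact fun h => h.2
  · intro h
    refine ⟨fun i => ?_, h⟩
    have hb := abs_le_boxR_of_dist_le h i
    rw [abs_le] at hb
    obtain ⟨h1, h2⟩ := hb
    constructor
    · exact_mod_cast h1
    · exact_mod_cast h2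

/-- `Deep Λ O s ↔ latticeBall s ⊆ Λ` (the registered sub-goal this Defs file carries). -/
theorem deep_O_iff_latticeBall_subset :
    ∀ (Λ : Finset HexVertex) (s : ℝ), Deep Λ O s ↔ latticeBall s ⊆ Λ := by
  intro Λ s
  constructor
  · intro h w hw
    exact h w (mem_latticeBall_iff.1 hw)
  · intro h w hw
    exact h (mem_latticeBall_iff.2 hw)

end Summit.CriticalPhenomena.SAWScalingLimit.Theorems.InteriorFlattening.Liouville

end
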